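/-
Origin: expansion seat `prover-pub-hodgecm-mc-binder-2-g14-0`, handover #S7 2026-08-20T12:17Z md5 6ad9c29011af (PKG 79463fc2e0c9 → 6ad9c29011af; 164 l.; NEW `abbrev printedAtσ (σ)`; `abbrev printedAt := printedAtσ V S hW jD m₁ m₂ 1` KEPT (byte-compatible for every consumer); `nonempty_hypCoreW₁₂/₃₄_wmInputCM₂g` σ-implicit (statements over `printedAtσ … σ` / `datumAtσ … σ`); proofs verbatim; NAME LIST: HodgeCM.Model.HypCensus.nonempty_hypCoreW₃₄_wmInputCM₂g) (`HOME/mc/pub-hodgecm-mc-binder-2/g14/s5b/HodgeCM/Model/HypCensus/SideWAssembly.lean`, md5 6ad9c29011af, 164 lines);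
landed by the gen-20 packager (p-g20) in gate run 51 REPLACES the earlier landed copy of `HodgeCM/Model/HypCensus/SideWAssembly.lean` (seat copy carried the packager Origin header of an earlier run (stripped)).
-/
/-
Origin: speedrun cell pub-hodgecm, MODEL-CONSTRUCTION sub-cell, lineage mc-binder-2 (BINDER-OWNERS rows 18/19: E binders
`hyp12` / `hyp34`), seat prover-pub-hodgecm-mc-binder-2-g12-0 (gen 12), 2026-08-20.
Target in PKG: `HodgeCM/Model/HypCensus/SideWAssembly.lean` (NEW additive leaf; imports this lineage's `HypCensus/InsMemKInf` (#51, RUN 41)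
and `HypCensus/Side34Smooth` (#54)).  KERNEL ONLY: 0 records, nothing cited, 0 `def … : Prop`; the residual junctions are HYPOTHESES.
-/
import Summits.HodgeConjecture.HodgeCM.Model.HypCensus.InsMemKInf
import Summits.HodgeConjecture.HodgeCM.Model.HypCensus.Side34Smooth

/-!
# Census kit (rows A12/A34): ASSEMBLY — `HypCoreW` at the W pin of record from the census, modulo NAMED residuals

The records `HypCoreW (W V c) c.D.jT₁₂ (-μ c 0) (-μ c 1)` / `… jT₃₄ (-μ c 2) (-μ c 3)` are what #23 `hyp12_of_sideW` / `hyp34_of_sideW`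
turn into E's binders `hyp12` / `hyp34` VERBATIM.  This leaf assembles them at the W pin of record
`W₀ = wmInputCM₂g V S hGR η hη hηc ι₁ V.sylvesterFrame _` from the census kit, field by field, leaving EXACTLY the named residuals
of the rows-18/19 ledger as hypotheses:

* row 18 (`jT₁₂`): **`nonempty_hypCoreW₁₂_wmInputCM₂g (hκ) (homg) (hdense)`** — `FinIdx := FinSB`, `ins := ins datumAt`, `ins_mem` := #51
  (mod `hκ` = (V-val)), `e := curveOf`, `e_zero`, `smooth` := #31 (CLOSED), `omg_ins := homg` (the `∀ φ` junction (J-T12); PROVED at `a • φ₀`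
  mod `hμ` by #39 — see the (T12)-ORIENTATION memo for why the `∀ φ` form is a residual), `dense := hdense` ((J-dense));
* row 19 (`jT₃₄`): **`nonempty_hypCoreW₃₄_wmInputCM₂g (hκ) (homg₃₄) (hdense)`** — the same with `ins₃₄`, `curve₃₄` (#53/#54); NOTE its `dense`
  hypothesis is row 18's `hdense` (transported by `dense₃₄_of_dense`) and its `ins_mem` uses the SAME `hκ`.

Nothing here is a claim of PerL/QW8.  Style lint (L-notation): no `local notation`.

**(T12)/(B1′) second table.** RULING S5b (B1′) re-base: `printedAtσ σ` / `datumAtσ … σ` with the torus twist `σ` IMPLICIT in both assembly theorems (row 18 is consumed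
at `σ = 1` through the byte-compatible `abbrev printedAt := printedAtσ … 1`; row 19 at `σ = sigma34 S`, where N4 `omgW_ins₃₄_eq_of_weight` supplies `homg₃₄`).
-/

set_option autoImplicit false

noncomputable section

open Filter Topology
open NumberField NumberField.InfinitePlace
open scoped TensorProduct Classical
open MvPolynomial
open Literature.NumberTheory.Automorphic Literature.NumberTheory.Automorphic.UnitaryGroup Literature.NumberTheory.Weil1964
open Literature.RepresentationTheory.KonnoKonno2007 Literature.RepresentationTheory.KonnoKonno2007.RealDualPair
open Literature.NumberTheory.GelbartRogawski1991 Literature.NumberTheory.GelbartRogawski1991.UnitaryDualPair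
open Literature.Analysis.SegalBargmann
open HodgeCM HodgeCM.Model HodgeCM.Adelic
open HodgeCM.PerL34 HodgeCM.PerL34.ArchC HodgeCM.PerL34.Fock HodgeCM.PerL34.Fock.PrintDict
open NumberField.SeesawArchTorus

namespace HodgeCM.Model.HypCensus

section Pin

variable {L : CMField} {ι₁ : L →+* ℂ} (V : HermSpace3 L ι₁) (S : StubTree.SeesawDatum L)
variable
  (hGR : (cmSplittingDatum (L : Type) finProdFinEquiv (frameD V) (frameD_real V) (frameD_ne V) (dW S) (dW_real S) (dW_ne S)).CompatibleSplitting)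
  (η : CMAdelic (L : Type) (frameD V) × CMAdelic (L : Type) (dW S) →* ℂˣ)
  (hη : ∀ γU ∈ CMRat (L : Type) (frameD V), ∀ γ ∈ CMRat (L : Type) (dW S), η (γU, γ) = 1)
  (hηc : Continuous fun p => ((η p : ℂˣ) : ℂ))
  (hV : IsAnisotropic L V.Hm)
  (hW : (∀ j, 0 < (ι₁ ((dW S) j)).re) ∨ ∀ j, (ι₁ ((dW S) j)).re < 0)
variable (jD : InfinitePlace (L : Type) → HodgeCM.PerL34.Fock.EqVar → Fin 6) (m₁ m₂ : InfinitePlace (L : Type) → ℤ)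
variable {σ : InfinitePlace (L : Type) → Equiv.Perm (Fin 2)}
variable
  (hκ : ∀ k : ↥(KInfty V),
    ((η (kPair V S ι₁ V.sylvesterFrame (sylvesterFrame_formCongr V) k) : ℂˣ) : ℂ) *
        ((pinLetterChar V S hGR hW (kVLetters V S (lett V S k)) : Circle) : ℂ) * dVIota V S (lett V S k (cmPlace (L : Type) ι₁)) =
      ((UnitaryGroup.archKappa (L : Type) V.Hm ι₁ V.sylvesterFrame (sylvesterFrame_formCongr V) k : ℂˣ) : ℂ))

/-- the printed archimedean structure of the chosen place data, the `W`-line indices read through the twist `σ` (abbreviation;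
`σ = 1` for the `jT₁₂` row, `σ = sigma34 S` (`placePerm⁻¹`, #52) for the `jT₃₄` row — (T12)/(B1′) orientation, RULING S5b). -/
abbrev printedAtσ (σ : InfinitePlace (L : Type) → Equiv.Perm (Fin 2)) :=
  printPlaces (InfinitePlace (L : Type))
    (kindOf (L : Type) (frameD V) (frameD_real V) (dW S) (dW_real S) ι₁ (datumAtσ V S jD (jIOf V S hW) σ))
    (lamOf (L : Type) (frameD V) (frameD_real V) (dW S) (dW_real S) ι₁ (datumAtσ V S jD (jIOf V S hW) σ))
    (lamOf_ne_zero (L : Type) (frameD V) (frameD_real V) (dW S) (dW_real S) ι₁ (datumAtσ V S jD (jIOf V S hW) σ))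
    (pinnedVacs (kindOf (L : Type) (frameD V) (frameD_real V) (dW S) (dW_real S) ι₁ (datumAtσ V S jD (jIOf V S hW) σ)) m₁ m₂)

/-- the printed archimedean structure of the chosen place data for the `jT₁₂` row (`σ = 1`; the abbreviation of record, kept
byte-compatible for every consumer: `printedAt V S hW jD m₁ m₂ = printedAtσ V S hW jD m₁ m₂ 1` by `rfl`). -/
abbrev printedAt :=
  printedAtσ V S hW jD m₁ m₂ 1

/-! ## Row 18: `HypCoreW` for the torus `jT₁₂` -/

include hV hκ in
/-- **ROW 18 ASSEMBLED: `HypCoreW (wmInputCM₂g …) S.jT₁₂ m₁ m₂` from the census**, modulo the named residuals `hκ` ((V-val)), `homg`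
((J-T12) in its `∀ φ` form) and `hdense` ((J-dense)). -/
theorem nonempty_hypCoreW₁₂_wmInputCM₂g
    (homg : ∀ (f : FinSB ↥(maximalRealSubfield L) (Fin 6)) (t : (printedAtσ V S hW jD m₁ m₂ σ).Tg) (φ : (printedAtσ V S hW jD m₁ m₂ σ).F),
      omgW (wmInputCM₂g V S hGR η hη hηc ι₁ V.sylvesterFrame (sylvesterFrame_formCongr V))
          (printedTorusHom (kindOf (L : Type) (frameD V) (frameD_real V) (dW S) (dW_real S) ι₁ (datumAtσ V S jD (jIOf V S hW) σ))
            (lamOf (L : Type) (frameD V) (frameD_real V) (dW S) (dW_real S) ι₁ (datumAtσ V S jD (jIOf V S hW) σ))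
            (lamOf_ne_zero (L : Type) (frameD V) (frameD_real V) (dW S) (dW_real S) ι₁ (datumAtσ V S jD (jIOf V S hW) σ))
            (S.jT₁₂.toMonoidHom.comp (toAdeles (L : Type)))
            (pinnedVacs (kindOf (L : Type) (frameD V) (frameD_real V) (dW S) (dW_real S) ι₁ (datumAtσ V S jD (jIOf V S hW) σ)) m₁ m₂) t)
          (ins (L : Type) (frameD V) (frameD_real V) (frameD_ne V) (dW S) (dW_real S) (dW_ne S) ι₁ (datumAtσ V S jD (jIOf V S hW) σ) m₁ m₂ f φ) =
        ins (L : Type) (frameD V) (frameD_real V) (frameD_ne V) (dW S) (dW_real S) (dW_ne S) ι₁ (datumAtσ V S jD (jIOf V S hW) σ) m₁ m₂ f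
          ((printedAtσ V S hW jD m₁ m₂ σ).ωT t φ))
    (hdense : ∀ Φ ∈ (wmInputCM₂g V S hGR η hη hηc ι₁ V.sylvesterFrame (sylvesterFrame_formCongr V)).SK,
      toTop (wmInputCM₂g V S hGR η hη hηc ι₁ V.sylvesterFrame (sylvesterFrame_formCongr V)) Φ ∈
        closure (toTop (wmInputCM₂g V S hGR η hη hηc ι₁ V.sylvesterFrame (sylvesterFrame_formCongr V)) ''
          (Submodule.span ℂ (Set.range fun q : FinSB ↥(maximalRealSubfield L) (Fin 6) × (printedAtσ V S hW jD m₁ m₂ σ).F =>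
            ins (L : Type) (frameD V) (frameD_real V) (frameD_ne V) (dW S) (dW_real S) (dW_ne S) ι₁ (datumAtσ V S jD (jIOf V S hW) σ) m₁ m₂ q.1 q.2) :
              Set (CMSchwartz (L : Type) 6)))) :
    Nonempty (HypCoreW (wmInputCM₂g V S hGR η hη hηc ι₁ V.sylvesterFrame (sylvesterFrame_formCongr V)) S.jT₁₂ m₁ m₂) :=
  ⟨{ kind := kindOf (L : Type) (frameD V) (frameD_real V) (dW S) (dW_real S) ι₁ (datumAtσ V S jD (jIOf V S hW) σ)
     lam := lamOf (L : Type) (frameD V) (frameD_real V) (dW S) (dW_real S) ι₁ (datumAtσ V S jD (jIOf V S hW) σ)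
     hlam := lamOf_ne_zero (L : Type) (frameD V) (frameD_real V) (dW S) (dW_real S) ι₁ (datumAtσ V S jD (jIOf V S hW) σ)
     side :=
      { FinIdx := FinSB ↥(maximalRealSubfield L) (Fin 6)
        ins := fun f => ins (L : Type) (frameD V) (frameD_real V) (frameD_ne V) (dW S) (dW_real S) (dW_ne S) ι₁
          (datumAtσ V S jD (jIOf V S hW) σ) m₁ m₂ f
        ins_mem := fun f φ => ins_mem_datumAt V S hGR η hη hηc hV hW jD m₁ m₂ hκ f φ
        dense := hdense
        omg_ins := homg
        e := fun b u s => curveOf V S (datumAtσ V S jD (jIOf V S hW) σ) b u s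
        e_zero := fun b u => curveOf_zero V S (datumAtσ V S jD (jIOf V S hW) σ) b u
        smooth := fun b u f φ => smooth_wmInputCM₂g V S hGR η hη hηc ι₁ V.sylvesterFrame (sylvesterFrame_formCongr V)
          (datumAtσ V S jD (jIOf V S hW) σ) m₁ m₂ hW b u f φ } }⟩

/-! ## Row 19: `HypCoreW` for the torus `jT₃₄` -/

include hV hκ in
/-- **ROW 19 ASSEMBLED: `HypCoreW (wmInputCM₂g …) S.jT₃₄ m₁ m₂` from the census** (insertion `ins₃₄`, curves `curve₃₄`), modulo the SAME
`hκ`, the (J-T34) `∀ φ` junction `homg₃₄`, and ROW 18's `hdense` (transported by #54 `dense₃₄_of_dense`). -/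
theorem nonempty_hypCoreW₃₄_wmInputCM₂g
    (homg₃₄ : ∀ (f : FinSB ↥(maximalRealSubfield L) (Fin 6)) (t : (printedAtσ V S hW jD m₁ m₂ σ).Tg) (φ : (printedAtσ V S hW jD m₁ m₂ σ).F),
      omgW (wmInputCM₂g V S hGR η hη hηc ι₁ V.sylvesterFrame (sylvesterFrame_formCongr V))
          (printedTorusHom (kindOf (L : Type) (frameD V) (frameD_real V) (dW S) (dW_real S) ι₁ (datumAtσ V S jD (jIOf V S hW) σ))
            (lamOf (L : Type) (frameD V) (frameD_real V) (dW S) (dW_real S) ι₁ (datumAtσ V S jD (jIOf V S hW) σ))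
            (lamOf_ne_zero (L : Type) (frameD V) (frameD_real V) (dW S) (dW_real S) ι₁ (datumAtσ V S jD (jIOf V S hW) σ))
            (S.jT₃₄.toMonoidHom.comp (toAdeles (L : Type)))
            (pinnedVacs (kindOf (L : Type) (frameD V) (frameD_real V) (dW S) (dW_real S) ι₁ (datumAtσ V S jD (jIOf V S hW) σ)) m₁ m₂) t)
          (ins₃₄ V S hGR η (datumAtσ V S jD (jIOf V S hW) σ) m₁ m₂ f φ) =
        ins₃₄ V S hGR η (datumAtσ V S jD (jIOf V S hW) σ) m₁ m₂ f ((printedAtσ V S hW jD m₁ m₂ σ).ωT t φ))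
    (hdense : ∀ Φ ∈ (wmInputCM₂g V S hGR η hη hηc ι₁ V.sylvesterFrame (sylvesterFrame_formCongr V)).SK,
      toTop (wmInputCM₂g V S hGR η hη hηc ι₁ V.sylvesterFrame (sylvesterFrame_formCongr V)) Φ ∈
        closure (toTop (wmInputCM₂g V S hGR η hη hηc ι₁ V.sylvesterFrame (sylvesterFrame_formCongr V)) ''
          (Submodule.span ℂ (Set.range fun q : FinSB ↥(maximalRealSubfield L) (Fin 6) × (printedAtσ V S hW jD m₁ m₂ σ).F =>
            ins (L : Type) (frameD V) (frameD_real V) (frameD_ne V) (dW S) (dW_real S) (dW_ne S) ι₁ (datumAtσ V S jD (jIOf V S hW) σ) m₁ m₂ q.1 q.2) :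
              Set (CMSchwartz (L : Type) 6)))) :
    Nonempty (HypCoreW (wmInputCM₂g V S hGR η hη hηc ι₁ V.sylvesterFrame (sylvesterFrame_formCongr V)) S.jT₃₄ m₁ m₂) :=
  ⟨{ kind := kindOf (L : Type) (frameD V) (frameD_real V) (dW S) (dW_real S) ι₁ (datumAtσ V S jD (jIOf V S hW) σ)
     lam := lamOf (L : Type) (frameD V) (frameD_real V) (dW S) (dW_real S) ι₁ (datumAtσ V S jD (jIOf V S hW) σ)
     hlam := lamOf_ne_zero (L : Type) (frameD V) (frameD_real V) (dW S) (dW_real S) ι₁ (datumAtσ V S jD (jIOf V S hW) σ)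
     side :=
      { FinIdx := FinSB ↥(maximalRealSubfield L) (Fin 6)
        ins := fun f => ins₃₄ V S hGR η (datumAtσ V S jD (jIOf V S hW) σ) m₁ m₂ f
        ins_mem := fun f φ => ins₃₄_mem_SK V S hGR η hη hηc ι₁ V.sylvesterFrame (sylvesterFrame_formCongr V)
          (datumAtσ V S jD (jIOf V S hW) σ) m₁ m₂ hW f φ (ins_mem_datumAt V S hGR η hη hηc hV hW jD m₁ m₂ hκ f φ)
        dense := dense₃₄_of_dense V S hGR η hη hηc ι₁ V.sylvesterFrame (sylvesterFrame_formCongr V) (datumAtσ V S jD (jIOf V S hW) σ)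
          m₁ m₂ hW (FinSB ↥(maximalRealSubfield L) (Fin 6)) id hdense
        omg_ins := homg₃₄
        e := fun b u s => curve₃₄ V S (datumAtσ V S jD (jIOf V S hW) σ) b u s
        e_zero := fun b u => curve₃₄_zero V S (datumAtσ V S jD (jIOf V S hW) σ) b u
        smooth := fun b u f φ => smooth₃₄_wmInputCM₂g V S hGR η hη hηc ι₁ V.sylvesterFrame (sylvesterFrame_formCongr V)
          (datumAtσ V S jD (jIOf V S hW) σ) m₁ m₂ hW b u f φ } }⟩

end Pin

end HodgeCM.Model.HypCensus

end
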